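import Literature.AlgebraicGeometry.ModuliOfAbelianVarieties.SiegelModuliComplexUniformisation   -- ★ (U): `IsAdmissibleAt`, Siegel currency
import Literature.AlgebraicGeometry.AbelianSchemes.AbelianSchemeDualPair                          -- ★ D2: `AbelianSchemeOver.DualPair`
import Literature.AlgebraicGeometry.AbelianVarieties.PoincareSheafNormalised                       -- ★ p699387: `dualOf`, `phiTheta`, `mumfordSheaf`
import Literature.AlgebraicGeometry.ModuliOfAbelianVarieties.SiegelAdmissibleOfNormalFormFrame   -- ★ (vi) p711701: U-aΘ currency (`AHData`/`intGram`/`picClass`/…)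
import Literature.AlgebraicGeometry.ModuliOfAbelianVarieties.SymplecticLiftOfMarking                -- ★ (b)-lane: `AdelicCongr` readings, `typeFormMod`
import Literature.AlgebraicGeometry.ModuliOfAbelianVarieties.SiegelAdmissibleOfIso                     -- ★ `fibreIdIso` transports
import Literature.AlgebraicGeometry.AbelianSchemes.AbelianSchemeIsLambdaOfAtConjugateTransport         -- ★ `IsLambdaOfAt` at geometric points
import Literature.AlgebraicGeometry.Motives.AbelianVarietyPolarizationTypeAnalytic                     -- ★ `HasType.complexTorus_isPolarizationType`
import Literature.AlgebraicGeometry.AbelianVarieties.PolarizationOfAmpleDivisor                     -- ★ (F1) p719228: `exists_polarization_of_dualPair`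
import Literature.AlgebraicGeometry.Motives.AbelianVarietyPicZeroOfAmple    -- ★ `AbelianVariety.linEquiv_of_picClass_eq` (GAGA injectivity on Pic)
import Literature.AlgebraicGeometry.Motives.AbelianVarietyAmpleRiemannForm  -- ★ `picClass_cartierDivisorLineBundle_nsmul`, `isRiemannForm_of_isAmple`
import Literature.AlgebraicGeometry.Motives.AbelianVarietyDegree           -- ★ `CartierDivisor.LinEquiv.isAmple`, `IsAmple.smul`
import Literature.AlgebraicGeometry.Motives.CartierDivisorAmpleOfSmul       -- ★ U-aΘ L3 p720489: `CartierDivisor.IsAmple.of_smul`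
import Literature.AlgebraicGeometry.ModuliOfAbelianVarieties.SiegelAdelicMarkingExists             -- ★ `SiegelAdelicMarking.exists`
import Literature.AlgebraicGeometry.ModuliOfAbelianVarieties.SiegelAdelicMarkingOfAnalytification  -- ★ `isLatticeBasis_one_of_mem_principalLevelSubgroup_one`, `dim_eq`
import Literature.AlgebraicGeometry.ModuliOfAbelianVarieties.SiegelAdmissibleExistence          -- ★ `SiegelAdelicMarking.exists_pairingRead_of_pairingRead`
import Literature.AlgebraicGeometry.Motives.AbelianVarietyWeilPairingNormalFormTransport        -- ★ `weilPairingLevel_eq_exp_pow_typeFormMod_of_mapMatrix`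
import Literature.AlgebraicGeometry.AbelianVarieties.PolarizationHasTypeOfComplexTorus        -- ★ (F2) p720921: `hasType_of_complexTorus_isPolarizationType`
import Literature.AlgebraicGeometry.HodgeTheory.GAGAPicardSurjective                             -- ★ U-aΘ L1 p721274: `uaTheta_L1_producer`
import Literature.AlgebraicGeometry.HodgeTheory.AmpleDivisorOfPositiveClass                     -- ★ U-aΘ L4 (B-p18 g15): `uaTheta_L4_ampleMultiple`
import Literature.AlgebraicGeometry.ModuliOfAbelianVarieties.SiegelAdelicMarkingFrame                -- ★ U-aΘ L0 p726629 (B-p15 g9): `uaTheta_L0_frameOfMarking`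
import Literature.AlgebraicGeometry.AbelianSchemes.SymplecticLiftGeometricPoints   -- ★ (symp) p722278: `LevelStructure.isSymplecticLiftable_of_identityFibre`
import Literature.AlgebraicGeometry.ModuliOfAbelianVarieties.SiegelMarkingLevelStructure   -- ★ (σ′) p722393: `SiegelAdelicMarking.exists_levelStructure_reading`
import Literature.AlgebraicGeometry.ModuliOfAbelianVarieties.SymplecticLiftOfMarkingIdentityFibre   -- ★ (O-Λ₁) p722880: `exists_marking_symplecticLift_id_of_cechClass_eq`
import Literature.AlgebraicGeometry.Motives.PoincareUniversal.DualPairOfAbelianVariety   -- part (A): `U_a3_dualPair_ofAbelianVariety_of_residual` (★-pending)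
import Literature.AlgebraicGeometry.AbelianSchemes.PolarizationUnitHypothesis   -- (R2⁺ ed. 2) `Polarization.nonempty_unitHatSlice_iso` for the field `hatNormalised`
import HarnessLib

/-!
# U-a, the tree edition: every Siegel point `(Z, r)` is realised by an admissible triple — GIVEN U-a3 (the M13 residual)

Cell hodgecm-mathlib, (U)-HEAD tree edition part (C) (B-plan2 (g11) 14:26:14Z / 14:35:44Z; source of truth UHead skeleton v0.16
`B-plan/probes/U-HEAD-skeleton.v0.16.B-plan2g11.lean` 9974d223; statement authors B-typ02 (g10/g11), assembly B-p18 (g14), glue B-plan2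
(g10); hand A-p06 (g12)).  THEOREMS ONLY: the U-a second + third layer of the UHead with EVERY socket discharged BY ★ NAME
(L0 p726629 `uaTheta_L0_frameOfMarking` · L1 p721274 · L4 p725976 `uaTheta_L4_ampleMultiple` · L3 p720489 · (F1) p719228 · (F2) p720921 ·
(σ′) p722393 · (O-Λ₁) p722880 · (symp) p722278); the one input that is NOT a tree theorem, U-a3, stays a hypothesis `hUa3` with its
socket text VERBATIM (= the P44 residual `U_a3_residual_poincareUniversal` by part (A) ★ `Motives.AbelianVariety.U_a3_dualPair_ofAbelianVariety_of_residual`).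
(b″) form: the conclusions are the UHead socket texts (`U_aTheta_ampleDivisorOfType_ofMarking`, `U_a_siegelAdmissibleTriple_exists`)
VERBATIM, so the skeleton's named-Prop consumers close by bare name through δ-unfolding.  No definition, no named fact, no instance, no `sorry`.
HC_CM is proved only modulo the printed citations until rung 0 closes.

* `uaTheta_ofMarking : <U_aTheta_ampleDivisorOfType_ofMarking TEXT>` — UHead `UaTheta_of`/`UaTheta_holds` with L0/L1/L4/L3 by ★ name.
* `ua_holds_of_dualPair (hUa3) : <U_a_siegelAdmissibleTriple_exists TEXT>` — UHead `Ua_assembly_of_symp`/`Ua_holds` with every socket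
  by ★ name.
* `Ua_holds_of_residual (hM13 : U_a3_residual_poincareUniversal) : <U_a_siegelAdmissibleTriple_exists TEXT>` — the head the UHead
  consumes (`U_of hF hM13 hE := Uglue_holds hF (Ua_holds_of_residual hM13) (Ue_holds hE)`), over part (A).

## References
* [Milne2005ShimuraVarieties] J. S. Milne, *Introduction to Shimura varieties* (2005), §6 Thm. 6.11 pp. 74–75, §12 (63) p. 116.
* [Deligne1971TravauxShimura] P. Deligne, *Travaux de Shimura*, Sém. Bourbaki 389 (1971), 4.12 (b) pp. 148–149, 4.16 p. 150.
* [MumfordFogartyKirwan1994] D. Mumford, J. Fogarty, F. Kirwan, *Geometric Invariant Theory*, 3rd ed. (1994), Appendix to Ch. 7 §A (p. 235).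
* [Lange2023AbelianVarietiesComplex] H. Lange, *Abelian Varieties over the Complex Numbers* (2023), §3.1 Thm. 3.1.2, §1.5.1.
* [MumfordAV1970] D. Mumford, *Abelian Varieties* (1970), §3 p. 29, §6 p. 60.
-/

set_option autoImplicit false

noncomputable section

open CategoryTheory CategoryTheory.Limits AlgebraicGeometry Matrix Topology
open Literature.AlgebraicGeometry.Motives (SchemeOver ComplexPoints AlgPoints specOver AbelianVariety CartierDivisor)
open Literature.AlgebraicGeometry.AbelianSchemes (PolarizedAbelianSchemeWithLevel AbelianSchemeOver)
open Literature.AlgebraicGeometry.AbelianVarieties (mumfordSheaf)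
open Literature.NumberTheory.Automorphic (siegelUpperHalfSpace)

namespace Literature.AlgebraicGeometry.ModuliOfAbelianVarieties.UHead

open Literature.AlgebraicGeometry.Motives (AbelianVariety AlgPoints CartierDivisor specOver ComplexPoints)
open Literature.AlgebraicGeometry.AbelianSchemes (AbelianSchemeOver PolarizedAbelianSchemeWithLevel)
open Literature.AlgebraicGeometry.AbelianSchemes.AbelianSchemeOver (fibreIdIso ofAbelianVariety Polarization)
open Literature.Geometry.Kaehler (ComplexTorus)
open Literature.Geometry.Kaehler.ComplexTorus (AHData proj mapMatrix intGram picClass)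
open Literature.NumberTheory.Transcendental (IsAnalytification)
open Literature.AlgebraicGeometry.HodgeTheory (cartierDivisorLineBundle picClass_cartierDivisorLineBundle_nsmul)
open Literature.AlgebraicGeometry.Modules (CechPic)
open Literature.NumberTheory.Adeles
open SiegelModuli

/-! ## §1 U-aΘ from its leaves, all ★: L0 p726629, L1 p721274, L4 p725976, L3 p720489 -/

/-- **U-aΘ — an ample divisor of type exactly `δ`, framed compatibly with the marking** (the UHead socket
`U_aTheta_ampleDivisorOfType_ofMarking`, text verbatim as the conclusion), from ★ L0 `uaTheta_L0_frameOfMarking` (the symplectic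
normal-form frame of the marking, B-p15 (g8/g9)), ★ L1 `HodgeTheory.uaTheta_L1_producer` (GAGA: every Appell–Humbert class is algebraic), ★ L4
`HodgeTheory.uaTheta_L4_ampleMultiple` (a positive power of a positive class is the class of an ample divisor) and ★ L3
`CartierDivisor.IsAmple.of_smul`; glue = ★ `picClass_cartierDivisorLineBundle_nsmul` + ★ GAGA-injectivity `linEquiv_of_picClass_eq` +
★ `LinEquiv.isAmple` (UHead `UaTheta_of`, B-plan2 (g10)).
[cite: Lange2023AbelianVarietiesComplex, §3.1 (3.1), Prop. 3.1.1, Thm. 3.1.2; §1.5.1] [cite: MumfordAV1970, §3 (Lefschetz) p. 29, §6 Appl. 1 p. 60]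
[cite: Milne2005ShimuraVarieties, §6 Thm. 6.11 p. 74] -/
theorem uaTheta_ofMarking :
    ∀ {g : ℕ} {δ : Fin g → ℕ} (hδ : IsPolarizationType δ) (Z : siegelUpperHalfSpace g)
      {r : gspFinAdelic δ} (_hr : r ∈ principalLevelSubgroup δ 1) {A₀ : AbelianVariety ℂ}
      (m : SiegelAdelicMarking ⟨jOfSiegel δ Z, jOfSiegel_coe_mem_C0pm hδ.1 Z⟩ r A₀),
      ∃ (Θ : CartierDivisor A₀.X.left) (_ : Θ.IsAmple)
        (ι : Type) (_ : Fintype ι) (_ : DecidableEq ι) (Φ : (ι → ℝ) ≃L[ℝ] (Fin A₀.dim → ℂ))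
        (φ : ComplexTorus Φ → ComplexPoints A₀.X) (hφ : IsAnalytification (Fin A₀.dim → ℂ) A₀.X A₀.dim φ)
        (_hadd : ∀ x y, φ (x + y) = φ x * φ y)
        (p : AHData Φ) (_hp : AHData.toPic p = picClass (cartierDivisorLineBundle hφ Θ))
        (_htype : ComplexTorus.IsPolarizationType Φ p.form δ)
        (T : Matrix ι (Fin g ⊕ Fin g) ℤ) (_hT : Tᵀ * intGram Φ p.form * T = typeForm δ),
        ∀ v : Fin g ⊕ Fin g → ℚ, m.r v = φ (mapMatrix m.Ψ Φ T (proj m.Ψ fun i => ((v i : ℚ) : ℝ))) := by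
  intro g δ hδ Z r hr A₀ m
  obtain ⟨ι, hι, hdec, Φ, φ, hφ, hadd, p, hR, htype, T, hT, hread⟩ := uaTheta_L0_frameOfMarking hδ Z hr m
  obtain ⟨Θ, hΘp⟩ := Literature.AlgebraicGeometry.HodgeTheory.uaTheta_L1_producer A₀ ι Φ φ hφ hadd p
  obtain ⟨q, hq, H, hH, hHp⟩ := Literature.AlgebraicGeometry.HodgeTheory.uaTheta_L4_ampleMultiple A₀ ι Φ φ hφ hadd p hR
  haveI : AlgebraicGeometry.IsIntegral A₀.X.left := AlgebraicGeometry.GeometricallyIntegral.isIntegral_of_subsingleton A₀.X.hom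
  have hcl : picClass (cartierDivisorLineBundle hφ (q • Θ)) = picClass (cartierDivisorLineBundle hφ H) := by
    rw [picClass_cartierDivisorLineBundle_nsmul hφ Θ q, hΘp, hHp]
  have hlin : (q • Θ).LinEquiv H := A₀.linEquiv_of_picClass_eq hφ hcl
  have hqΘ : (q • Θ).IsAmple := hlin.symm.isAmple hH
  exact ⟨Θ, hqΘ.of_smul hq, ι, hι, hdec, Φ, φ, hφ, hadd, p, hΘp.symm, htype, T, hT, hread⟩

/-! ## §2 The (O-Ua) assembler with every socket discharged by ★ name -/

/-- **U-a GIVEN U-a3 — the (O-Ua) ASSEMBLER with every socket discharged by ★ name** (UHead `Ua_assembly_of_symp` / `Ua_holds`,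
B-p18 (g14) / B-plan2 (g10), proof verbatim up to the substitutions): the record `P′ := ⟨ofAbelianVariety A₀, relDim, D, pol, hasType,
φσ, symplectic⟩` and `IsAdmissibleAt hδ r Z hZ P′ := ⟨m₁, Θ₁, Λ, hamp, h₁, hmatch⟩` from: `A₀` marked by `[J(Z), r]` (★
`SiegelAdelicMarking.exists`, `γ = 1`), the U-aΘ package (`uaTheta_ofMarking`), U-a3 (hypothesis `hUa3`, = the P44 residual by
`Motives.AbelianVariety.U_a3_dualPair_ofAbelianVariety_of_residual`), (F1) ★ `exists_polarization_of_dualPair`, (F2) ★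
`hasType_of_complexTorus_isPolarizationType`, (σ′) ★ `SiegelAdelicMarking.exists_levelStructure_reading`, the pairing read through
`b = 1` (★ `weilPairingLevel_eq_exp_pow_typeFormMod_of_mapMatrix`) and re-read through `r⁻¹` (★ `exists_pairingRead_of_pairingRead`),
(O-Λ₁) ★ `exists_marking_symplecticLift_id_of_cechClass_eq`, (symp) ★ `LevelStructure.isSymplecticLiftable_of_identityFibre`,
`relDim` ★ `isOfRelDim_ofAbelianVariety`.
[cite: Milne2005ShimuraVarieties, §6 Thm. 6.11 pp. 74–75 and §12 (63) p. 116] [cite: Deligne1971TravauxShimura, 4.12 (b) pp. 148–149 and 4.16 p. 150]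
[cite: MumfordFogartyKirwan1994, Appendix to Ch. 7 §A (p. 235)] -/
theorem ua_holds_of_dualPair
    (hUa3 :
      ∀ (A : AbelianVariety ℂ) (Θ : CartierDivisor A.X.left) (hΘ : Θ.IsAmple),
        ∃ (D : (AbelianSchemeOver.ofAbelianVariety A).DualPair)
          (e : D.hat.X ≅ (AbelianSchemeOver.ofAbelianVariety (A.dualOf Θ hΘ)).X) (_ : IsMonHom e.hom),
          Nonempty
            (D.pullbackP A.X.hom (AbelianVariety.Hom.toSchemeHom (A.phiTheta Θ hΘ) ≫ e.inv.left)
                (by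
                  rw [Category.assoc]
                  exact (congrArg (AbelianVariety.Hom.toSchemeHom (A.phiTheta Θ hΘ) ≫ ·) (Over.w e.inv)).trans
                    (Over.w (A.phiTheta Θ hΘ).hom.hom.hom)) ≅
              mumfordSheaf A Θ)) :
    ∀ (g N : ℕ) (δ : Fin g → ℕ) (_hg : 0 < g) (hδ : IsPolarizationType δ) (_hN : 3 ≤ N)
      (c : (ZMod N)ˣ) (u : finAdeleQˣ) (r : gspFinAdelic δ),
      -- `r = diag(1, u·1)` is a principal representative of the component index `c` (the four `r`-binders of ★ (U) (U3), verbatim)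
      (∀ v, Valued.v ((u : finAdeleQ) v) = 1) →
      (u : finAdeleQ) - ((c : ZMod N).val : ℕ) ∈ levelIdeal N →
      r ∈ principalLevelSubgroup δ 1 →
      IsMultiplier (typeFormOver δ finAdeleQ) (r : GL (Fin g ⊕ Fin g) finAdeleQ) u →
      ((r : GL (Fin g ⊕ Fin g) finAdeleQ) : Matrix (Fin g ⊕ Fin g) (Fin g ⊕ Fin g) finAdeleQ) =
        Matrix.fromBlocks 1 0 0 ((u : finAdeleQ) • (1 : Matrix (Fin g) (Fin g) finAdeleQ)) →
      ∀ (Z : Matrix (Fin g) (Fin g) ℂ) (hZ : Z ∈ siegelUpperHalfSpace g),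
        ∃ P' : PolarizedAbelianSchemeWithLevel g N δ (specOver ℚ ℂ).left, IsAdmissibleAt hδ r Z hZ P' := by
  intro g N δ hg hδ hN c u r _hu _huc hr1 _hmult _hrblk Z hZ
  have hN0 : N ≠ 0 := by omega
  -- a complex abelian variety marked by `[J(Z), r]` (`Λ_r = ℤ^{2g}` since `r ∈ K_δ(1)`)
  obtain ⟨A₀, ⟨m⟩⟩ := SiegelAdelicMarking.exists
    (⟨jOfSiegel δ Z, SiegelComplexRecordSystem.jOfSiegel_mem_C0pm hδ.1 hZ⟩ : C0pm δ) r (1 : GL (Fin g ⊕ Fin g) ℚ)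
    (isLatticeBasis_one_of_mem_principalLevelSubgroup_one hr1)
  -- the U-aΘ package on the marked variety
  obtain ⟨Θ, hΘa, ι, hι, hdec, Φ, φ, hφ, hadd, p, hp, htype, T, hT, hread⟩ := uaTheta_ofMarking hδ ⟨Z, hZ⟩ hr1 m
  -- U-a3 and (F1): dual pair, polarisation `λ = φ_Θ ≫ e⁻¹`, class-level ample witness `Θ₁` at the identity point
  obtain ⟨D, e, he, eP⟩ := hUa3 A₀ Θ hΘa
  obtain ⟨pol, -, Θ₁, hΘ₁a, hlam₁, hcl⟩ :=
    Literature.AlgebraicGeometry.AbelianVarieties.exists_polarization_of_dualPair A₀ Θ hΘa D e he eP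
  -- (F2): the polarisation has type `δ`
  have hdim : A₀.dim = g := m.dim_eq
  have hR : Literature.Geometry.Kaehler.ComplexTorus.IsRiemannForm Φ p.form :=
    AbelianVariety.isRiemannForm_of_isAmple A₀ hφ hadd hΘa p hp
  have hHas : pol.HasType δ :=
    Literature.AlgebraicGeometry.AbelianVarieties.hasType_of_complexTorus_isPolarizationType
      A₀ D pol g δ Θ Θ₁ hcl hlam₁ ι Φ φ hφ hadd hdim p hp hR htype
  -- (σ′): the level-`N` structure read off the marking
  obtain ⟨φσ, hlevel⟩ := SiegelAdelicMarking.exists_levelStructure_reading m hN0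
  -- the roots of unity `ζ_M = e(2πi/M)` and the pairing READ THROUGH `b = 1` (the `x̃/M` lines of ★ (vi))
  set ζ : ℕ → ℂ := fun M => Complex.exp (2 * Real.pi * Complex.I / M) with hζ_def
  have hζ : ∀ ⦃M : ℕ⦄, N ∣ M → M ≠ 0 → IsPrimitiveRoot (ζ M) M := fun M _ hM =>
    Complex.isPrimitiveRoot_exp M hM
  have hζ_pow : ∀ ⦃M : ℕ⦄ (k : ℕ), N ∣ M → M ≠ 0 → k ≠ 0 → ζ (k * M) ^ k = ζ M := by
    intro M k _ hM hk
    have hMc : (M : ℂ) ≠ 0 := Nat.cast_ne_zero.2 hM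
    have hkc : (k : ℂ) ≠ 0 := Nat.cast_ne_zero.2 hk
    simp only [hζ_def]
    rw [← Complex.exp_nat_mul]
    congr 1
    push_cast
    field_simp
  have hone : ∀ v : Fin g ⊕ Fin g → ℚ,
      AdelicCongr (((1 : gspFinAdelic δ)⁻¹ : gspFinAdelic δ) : GL (Fin g ⊕ Fin g) finAdeleQ) 1 v v := by
    intro v i
    rw [inv_one, OneMemClass.coe_one, Pi.sub_apply, sub_self]
    exact zero_mem _
  have hvec : ∀ {M : ℕ} (x : Fin g ⊕ Fin g → ZMod M),
      (fun i => ((((fun j => ((x j).val : ℚ) / M) i : ℚ) : ℝ))) = (M : ℝ)⁻¹ • fun i => ((x i).val : ℝ) := by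
    intro M x
    funext i
    simp only [Pi.smul_apply, smul_eq_mul, Rat.cast_div, Rat.cast_natCast]
    ring
  have hpair : ∀ ⦃M : ℕ⦄, N ∣ M → ∀ (hMΩ : (M : ℂ) ≠ 0) (x y : Fin g ⊕ Fin g → ZMod M)
      (P Q : A₀.torsionPoints ℂ (M : ℤ)),
      (∀ v, AdelicCongr (((1 : gspFinAdelic δ)⁻¹ : gspFinAdelic δ) : GL (Fin g ⊕ Fin g) finAdeleQ) 1 v
          (fun i => ((x i).val : ℚ) / M) → (P : A₀.Points ℂ) = m.r v) →
      (∀ w, AdelicCongr (((1 : gspFinAdelic δ)⁻¹ : gspFinAdelic δ) : GL (Fin g ⊕ Fin g) finAdeleQ) 1 w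
          (fun i => ((y i).val : ℚ) / M) → (Q : A₀.Points ℂ) = m.r w) →
      haveI := AbelianVariety.isDominant_toSchemeHom_zsmul_of_ne_zero A₀ hMΩ
      A₀.weilPairingLevel Θ P Q = ζ M ^ (AbelianSchemeOver.typeFormMod δ M x y).val := by
    intro M _ hMΩ x y P Q hP hQ
    have hM : M ≠ 0 := by rintro rfl; exact hMΩ Nat.cast_zero
    haveI := AbelianVariety.isDominant_toSchemeHom_zsmul_of_ne_zero A₀ hMΩ
    have hPx := hP _ (hone _)
    have hQy := hQ _ (hone _)
    rw [hread, hvec] at hPx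
    rw [hread, hvec] at hQy
    exact AbelianVariety.weilPairingLevel_eq_exp_pow_typeFormMod_of_mapMatrix hφ hadd hM Θ p hp T hT x y P Q hPx hQy
  -- frame change `1 ↦ r`: the readings THROUGH `r⁻¹`, with a twisted compatible system `ζ₁` ([Del71] 4.16)
  obtain ⟨ζ₁, hζ₁, hζ₁_pow, hpair₁⟩ := m.exists_pairingRead_of_pairingRead hδ hg Θ (one_mem _) hr1 ζ hζ hζ_pow hpair
  -- (O-Λ₁): marking `m₁` and matched symplectic lift `Λ` on the identity fibre
  obtain ⟨m₁, Λ, -, -, -, hmatch⟩ :=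
    m.exists_marking_symplecticLift_id_of_cechClass_eq φσ Θ ζ₁ hζ₁ hζ₁_pow hpair₁ hlevel Θ₁ hcl
  -- the triple `P′` and its admissibility at `(Z, r)`
  have hrel : (Literature.AlgebraicGeometry.AbelianSchemes.AbelianSchemeOver.ofAbelianVariety A₀).IsOfRelDim g :=
    hdim ▸ Literature.AlgebraicGeometry.AbelianSchemes.AbelianSchemeOver.isOfRelDim_ofAbelianVariety A₀
  have hsymp : φσ.IsSymplecticLiftable pol δ :=
    Literature.AlgebraicGeometry.AbelianSchemes.AbelianSchemeOver.LevelStructure.isSymplecticLiftable_of_identityFibre D pol hlam₁ ⟨Λ⟩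
  -- (R2⁺ ed. 2) the 8th field `hatNormalised`: the base `Spec ℂ` is reduced, so the polarisation gives it
  have hN : Nonempty ((Scheme.Modules.pullback
      (Literature.AlgebraicGeometry.AbelianSchemes.AbelianSchemeOver.DualPair.unitHatSlice D)).obj D.P ≅
        SheafOfModules.unit _) :=
    pol.nonempty_unitHatSlice_iso
  exact ⟨⟨Literature.AlgebraicGeometry.AbelianSchemes.AbelianSchemeOver.ofAbelianVariety A₀, hrel, D, pol, hHas, φσ, hsymp, hN⟩,
    m₁, Θ₁, Λ, hΘ₁a, hlam₁, hmatch⟩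

/-! ## §3 The head the UHead consumes: U-a from the M13 residual (part (A)) -/

/-- **U-a GIVEN the M13 residual** — `Ua_holds_of_residual : U_a3_residual_poincareUniversal → <U_a_siegelAdmissibleTriple_exists text>`
((b″) form: the conclusion is the UHead v0.16/v0.17 socket `U_a_siegelAdmissibleTriple_exists` (:396–:418) VERBATIM, so the skeleton's
`Ua_holds : U_a_siegelAdmissibleTriple_exists` closes as `:= Ua_holds_of_residual hM13` by δ-unfolding):
part (A) ★ `Motives.AbelianVariety.U_a3_dualPair_ofAbelianVariety_of_residual` (junction 3) feeds `ua_holds_of_dualPair`.  This is the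
`hUa`-side input of the (U)-glue (`UHead.U_of hF hM13 hE := Uglue_holds hF (Ua_holds_of_residual hM13) (Ue_holds hE)`). [cite: Milne2005ShimuraVarieties, §6 Thm. 6.11 pp. 74–75 and §12 (63) p. 116] [cite: MumfordFogartyKirwan1994, Appendix to Ch. 7 §A (p. 235)] -/
theorem Ua_holds_of_residual
    (hM13 : Literature.AlgebraicGeometry.Motives.AbelianVariety.U_a3_residual_poincareUniversal) :
    ∀ (g N : ℕ) (δ : Fin g → ℕ) (_hg : 0 < g) (hδ : IsPolarizationType δ) (_hN : 3 ≤ N)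
      (c : (ZMod N)ˣ) (u : finAdeleQˣ) (r : gspFinAdelic δ),
      -- `r = diag(1, u·1)` is a principal representative of the component index `c` (the four `r`-binders of ★ (U) (U3), verbatim)
      (∀ v, Valued.v ((u : finAdeleQ) v) = 1) →
      (u : finAdeleQ) - ((c : ZMod N).val : ℕ) ∈ levelIdeal N →
      r ∈ principalLevelSubgroup δ 1 →
      IsMultiplier (typeFormOver δ finAdeleQ) (r : GL (Fin g ⊕ Fin g) finAdeleQ) u →
      ((r : GL (Fin g ⊕ Fin g) finAdeleQ) : Matrix (Fin g ⊕ Fin g) (Fin g ⊕ Fin g) finAdeleQ) =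
        Matrix.fromBlocks 1 0 0 ((u : finAdeleQ) • (1 : Matrix (Fin g) (Fin g) finAdeleQ)) →
      ∀ (Z : Matrix (Fin g) (Fin g) ℂ) (hZ : Z ∈ siegelUpperHalfSpace g),
        ∃ P' : PolarizedAbelianSchemeWithLevel g N δ (specOver ℚ ℂ).left, IsAdmissibleAt hδ r Z hZ P' :=
  ua_holds_of_dualPair (Literature.AlgebraicGeometry.Motives.AbelianVariety.U_a3_dualPair_ofAbelianVariety_of_residual hM13)

end Literature.AlgebraicGeometry.ModuliOfAbelianVarieties.UHead

end
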